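import Literature.NumberTheory.PAdicHodge.UnitRootFramePeriods
import HarnessLib

/-!
# Kato's (K₂) in the UNIT-ROOT frame: `t·Λ/x ∈ ℚ_p · (A_max)^{φ=p}` is a Teichmüller logarithm modulo `Fil²`

Topic `Literature/NumberTheory/PAdicHodge`; namespace `Literature.NumberTheory.PAdicHodge`. THEOREMS ONLY (no definition, no named fact, no instance,
no `sorry`). Sequel of `UnitRootFramePeriods` (the eigen-relations `φx = πx`, `φΛ = πΛ`, Fontaine's lemma `p^k·ux = ι(c)·t` and the period property
of `u` in the height-one frame `απ = p`, `φu = αu`, Honda `(φ−α)(φ−π) = 0`, Hodge pair `H₀ = ι(A)f(x) + ι(B)f(φx) ∈ Fil¹ ∖ 0`).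

* ★★★ `exists_isTeichLog_pow_mul_of_mul_hodgePair_eq` — **(K₂) for the height-one frame**: with `H_Λ = ι(A)f(Λ) + ι(B)f(φΛ)`, every `X ∈ B_dR⁺`
  with `X·H₀ = ι(e₀)·t·H_Λ` (`e₀ ∈ ℤ_p`) satisfies `IsTeichLog 2 (p^M·X)` for some `M`: `H₀ = ι(A+Bπ)f(x)`, `H_Λ = ι(A+Bπ)f(Λ)`,
  `p^k f(u)f(x) = ι(c)t_dR`, so `ι(c)·X = e₀p^k·f(uΛ)` with `uΛ ∈ (A_max)^{φ=p}` (`φ(uΛ) = αu·πΛ`), and `(A_max)^{φ=p} ⊆ ℚ_p ⊗ X⁰₂`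
  (`isTeichLog_pow_mul_bmaxPlusToBdR`).

BSD context: line `kato_lever` of crux K★ `stmt-BirchSwinnertonDyer-22226`, stub `stub_localFormulaOrdinaryCells` (the (G)-ORDINARY starred cells), memo
`Summits/BirchSwinnertonDyer/BirchSwinnertonDyer/Cruxes/StarredOptimalManinUnitFiveSeven/Lines/kato-lever-seam-rec-at-cells.md` §17 «unit-root frame»: with
`Pη(a) = ē(a)·u` and `b_η = 0` the socket `TatePairingPointOfKTwoBasis` asks (K₂) for `X = x̃(v₁) = c_L⁻¹·Pη(v₁)·b_ω`, and its Legendre relation reads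
`X·H₀ = e₀·t·H_P` — exactly the hypothesis here. Infrastructure only: BSD / K★ are NOT proved by any of this; nothing about elliptic curves is proved here.

## References
* [Kato1993LNM1553] K. Kato, LNM 1553 (1993), Ch. II Thm. 1.4.1, Lemma 1.4.3.
* [BlochKato1990] S. Bloch, K. Kato (1990), Example 3.11.
* [FontaineOuyang2022] J.-M. Fontaine, Y. Ouyang, *Theory of p-adic Galois representations*, §6.1.
* [FontaineAsterisque223III] J.-M. Fontaine, Astérisque 223 (1994), Exp. III Th. 5.3.7.
* [Colmez1998Annals] P. Colmez, Ann. of Math. 148 (1998), §III.2–III.3.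
-/

noncomputable section

open WittVector Field ValuativeRel

namespace Literature.NumberTheory.PAdicHodge

open Literature.NumberTheory.GaloisRepresentations
open Literature.NumberTheory.GaloisRepresentations.IsNonarchimedeanLocalField
open GaloisContinuity

variable {F : Type} [Field F] [ValuativeRel F] [TopologicalSpace F] [IsNonarchimedeanLocalField F]
  [CharZero F] {p : ℕ} [Fact p.Prime] [Fact (¬ IsUnit (p : integerC F))]
  [IsAdicComplete (Ideal.span {(p : integerC F)}) (integerC F)]

/-! ## Kato's (K₂) in the unit-root frame -/

set_option maxHeartbeats 3200000 in
set_option synthInstance.maxHeartbeats 400000 in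
/-- ★★★ **(K₂) for the height-one frame.** In the situation of `frobBmaxPlus_kummer_eq_pi_mul`, put `H₀ = ι(A)f(x) + ι(B)f(φx)` and
`H_Λ = ι(A)f(Λ) + ι(B)f(φΛ)` (`f = bmaxPlusToBdR`). Then every `X ∈ B_dR⁺` with **`X · H₀ = ι(e₀)·t·H_Λ`** (`e₀ ∈ ℤ_p`) is, up to a power of `p`, a
Teichmüller logarithm modulo `Fil²`: **`IsTeichLog 2 (p^M·X)`**. Indeed `H₀ = ι(A+Bπ)f(x)`, `H_Λ = ι(A+Bπ)f(Λ)`, `p^k f(u)f(x) = ι(c)t_dR`, so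
`ι(c)·X = e₀p^k·f(uΛ)` with `uΛ ∈ (A_max)^{φ=p}` (`φ(uΛ) = αu·πΛ`), and `(A_max)^{φ=p} ⊆ ℚ_p ⊗ X⁰₂` (`isTeichLog_pow_mul_bmaxPlusToBdR`). This is the
(K₂) hypothesis of `TatePairingPointOfKTwoBasis` for the resolution `x̃(v₁) = c_L⁻¹Pη(v₁)b_ω` of the unit-root frame (`X·H₀ = e₀·t·H_P` is its Legendre
relation). [cite: Kato1993LNM1553, Ch. II Thm. 1.4.1, Lemma 1.4.3] [cite: BlochKato1990, Example 3.11] [cite: FontaineOuyang2022, §6.1] -/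
theorem exists_isTeichLog_pow_mul_of_mul_hodgePair_eq (hF : Function.Surjective (fontaineTheta (integerC F) p)) (hpv : valuation F p < 1)
    {α π : ℤ_[p]} (hαπ : α * π = p) {u : BmaxPlus F p} (hu : IsUnit u)
    (hφu : frobBmaxPlus F p u = ainfToBmaxPlus F p (zpToAinf α) * u) {x : BmaxPlus F p}
    (hx : frobBmaxPlus F p (frobBmaxPlus F p x) - ainfToBmaxPlus F p (zpToAinf (α + π)) * frobBmaxPlus F p x + (p : BmaxPlus F p) * x = 0)
    (ρ : absoluteGaloisGroup F → ℤ_[p]) (hρ : ∀ σ, galBmaxPlus σ x = ainfToBmaxPlus F p (zpToAinf (ρ σ)) * x)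
    {A B : F} (hfil : thetaBdR (embBdRHom hpv hF A * bmaxPlusToBdR F p x + embBdRHom hpv hF B * bmaxPlusToBdR F p (frobBmaxPlus F p x)) = 0)
    (hne : embBdRHom hpv hF A * bmaxPlusToBdR F p x + embBdRHom hpv hF B * bmaxPlusToBdR F p (frobBmaxPlus F p x) ≠ 0)
    (hρχ : ∃ σ₁, ρ σ₁ ≠ ((GaloisRep.cyclotomicCharacter F p σ₁ : ℤ_[p]ˣ) : ℤ_[p]))
    {Λ : BmaxPlus F p}
    (hΛ : frobBmaxPlus F p (frobBmaxPlus F p Λ) - ainfToBmaxPlus F p (zpToAinf (α + π)) * frobBmaxPlus F p Λ + (p : BmaxPlus F p) * Λ = 0)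
    (kum : absoluteGaloisGroup F → ℤ_[p]) (hgalΛ : ∀ σ, galBmaxPlus σ Λ = Λ + ainfToBmaxPlus F p (zpToAinf (kum σ)) * x)
    (e₀ : ℤ_[p]) {X : BDeRhamPlus (integerC F) p}
    (hX : X * (embBdRHom hpv hF A * bmaxPlusToBdR F p x + embBdRHom hpv hF B * bmaxPlusToBdR F p (frobBmaxPlus F p x)) =
      qpToBdR (e₀ : ℚ_[p]) * tBdR * (embBdRHom hpv hF A * bmaxPlusToBdR F p Λ + embBdRHom hpv hF B * bmaxPlusToBdR F p (frobBmaxPlus F p Λ))) :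
    ∃ M : ℕ, IsTeichLog 2 ((p : BDeRhamPlus (integerC F) p) ^ M * X) := by
  haveI : IsDomain (BDeRhamPlus (integerC F) p) := isDomain_bDeRhamPlus hF
  have hφΛ := frobBmaxPlus_kummer_eq_pi_mul hF hpv hαπ hu hφu hx ρ hρ hfil hne hρχ hΛ kum hgalΛ
  obtain ⟨-, hγ, hH⟩ := thetaBmaxPlus_eq_zero_of_honda_of_hodgePair hF hpv hαπ hu hφu hx ρ hρ hfil hne
  obtain ⟨k, c, hc0, hkc⟩ := exists_pow_mul_unitRoot_mul_eq_tBmax hF hpv hαπ hu hφu hx ρ hρ hfil hne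
  obtain ⟨γ, hγdef⟩ : ∃ γ : F, γ = A + B * LocalField.padicRingHom F p hpv (π : ℚ_[p]) := ⟨_, rfl⟩
  rw [← hγdef] at hγ hH
  obtain ⟨fu, hfu⟩ : ∃ y, y = bmaxPlusToBdR F p u := ⟨_, rfl⟩
  obtain ⟨fx, hfx⟩ : ∃ y, y = bmaxPlusToBdR F p x := ⟨_, rfl⟩
  obtain ⟨fΛ, hfΛ⟩ : ∃ y, y = bmaxPlusToBdR F p Λ := ⟨_, rfl⟩
  have hπ' : embBdRHom hpv hF (LocalField.padicRingHom F p hpv (π : ℚ_[p])) = bmaxPlusToBdR F p (ainfToBmaxPlus F p (zpToAinf π)) := by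
    rw [AinfRam.embBdRHom_padicRingHom' (hp := hpv) hF, bmaxPlusToBdR_ainfToBmaxPlus_zpToAinf]
  -- `H_Λ = ι(γ)·f(Λ)`
  have hHΛ : embBdRHom hpv hF A * bmaxPlusToBdR F p Λ + embBdRHom hpv hF B * bmaxPlusToBdR F p (frobBmaxPlus F p Λ) =
      embBdRHom hpv hF γ * fΛ := by
    rw [hφΛ, map_mul, ← hπ', hγdef, map_add, map_mul, ← hfΛ]; ring
  rw [hH, hHΛ, ← hfx] at hX
  -- cancel `ι(γ) ≠ 0`
  have hγ0 : embBdRHom hpv hF γ ≠ 0 := (map_ne_zero_iff _ (embBdRHom hpv hF).injective).2 hγ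
  have hX1 : X * fx = qpToBdR (e₀ : ℚ_[p]) * tBdR * fΛ := by
    have h : embBdRHom hpv hF γ * (X * fx - qpToBdR (e₀ : ℚ_[p]) * tBdR * fΛ) = 0 := by linear_combination hX
    exact sub_eq_zero.1 ((mul_eq_zero.1 h).resolve_left hγ0)
  -- `p^k f(u) f(x) = ι(c) t_dR`
  have hkc' : (p : BDeRhamPlus (integerC F) p) ^ k * (fu * fx) = qpToBdR (c : ℚ_[p]) * tBdR := by
    have h := congrArg (bmaxPlusToBdR F p) hkc
    rwa [map_mul, map_pow, map_natCast, map_mul, map_mul, bmaxPlusToBdR_tBmax, bmaxPlusToBdR_ainfToBmaxPlus_zpToAinf, ← hfu, ← hfx] at h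
  -- `ι(c)·X = e₀ p^k · f(uΛ)`
  have hX2 : qpToBdR (c : ℚ_[p]) * X = qpToBdR (e₀ : ℚ_[p]) * (p : BDeRhamPlus (integerC F) p) ^ k * bmaxPlusToBdR F p (u * Λ) := by
    have h : tBdR * (qpToBdR (c : ℚ_[p]) * X - qpToBdR (e₀ : ℚ_[p]) * (p : BDeRhamPlus (integerC F) p) ^ k * (fu * fΛ)) = 0 := by
      linear_combination (-X) * hkc' + ((p : BDeRhamPlus (integerC F) p) ^ k * fu) * hX1
    rw [map_mul, ← hfu, ← hfΛ]
    exact sub_eq_zero.1 ((mul_eq_zero.1 h).resolve_left (tBdR_ne_zero hF))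
  -- `uΛ ∈ (A_max)^{φ=p}`
  have hφuΛ : frobBmaxPlus F p (u * Λ) = (p : BmaxPlus F p) * (u * Λ) := by
    have hp' : (p : BmaxPlus F p) = ainfToBmaxPlus F p (zpToAinf α) * ainfToBmaxPlus F p (zpToAinf π) := by
      rw [← map_mul, ← map_mul, hαπ, map_natCast, map_natCast]
    rw [map_mul, hφu, hφΛ, hp']; ring
  obtain ⟨M, hM⟩ := isTeichLog_pow_mul_bmaxPlusToBdR hF hpv (k := 2) (by norm_num) hφuΛ
  -- `c = c₁ · p^j`, `c₁` a unit
  have hcdec := PadicInt.unitCoeff_spec hc0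
  obtain ⟨c₁, hc₁⟩ : ∃ c₁ : ℤ_[p]ˣ, c₁ = PadicInt.unitCoeff hc0 := ⟨_, rfl⟩
  rw [← hc₁] at hcdec
  refine ⟨c.valuation + M, ?_⟩
  -- `p^{j+M} X = c₁⁻¹ · e₀ · p^k · (p^M f(uΛ))`
  have hT : IsTeichLog 2 (qpToBdR ((c₁⁻¹ : ℤ_[p]ˣ) : ℤ_[p]) * (qpToBdR (e₀ : ℚ_[p]) *
      (((p ^ k : ℕ) : BDeRhamPlus (integerC F) p) * ((p : BDeRhamPlus (integerC F) p) ^ M * bmaxPlusToBdR F p (u * Λ))))) :=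
    ((hM.natCast_mul (p ^ k)).padicInt_smul e₀).padicInt_smul _
  have hinv : qpToBdR (((c₁⁻¹ : ℤ_[p]ˣ) : ℤ_[p]) : ℚ_[p]) * qpToBdR ((c₁ : ℤ_[p]) : ℚ_[p]) = (1 : BDeRhamPlus (integerC F) p) := by
    rw [← map_mul, ← PadicInt.coe_mul, Units.inv_mul, PadicInt.coe_one, map_one]
  have hcq : qpToBdR (c : ℚ_[p]) = qpToBdR ((c₁ : ℤ_[p]) : ℚ_[p]) * (p : BDeRhamPlus (integerC F) p) ^ c.valuation := by
    conv_lhs => rw [hcdec]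
    rw [PadicInt.coe_mul, map_mul, PadicInt.coe_pow, map_pow, PadicInt.coe_natCast, map_natCast]
  convert hT using 1
  rw [Nat.cast_pow, pow_add]
  linear_combination (qpToBdR (((c₁⁻¹ : ℤ_[p]ˣ) : ℤ_[p]) : ℚ_[p]) * (p : BDeRhamPlus (integerC F) p) ^ M) * hX2
    + (-(X * (p : BDeRhamPlus (integerC F) p) ^ c.valuation * (p : BDeRhamPlus (integerC F) p) ^ M)) * hinv
    + (-(qpToBdR (((c₁⁻¹ : ℤ_[p]ˣ) : ℤ_[p]) : ℚ_[p]) * (p : BDeRhamPlus (integerC F) p) ^ M * X)) * hcq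

end Literature.NumberTheory.PAdicHodge

end
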